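import Summits.QuantumFields.YangMills.Theorems.BalabanUVNodesK0Stub1FlatHessianLandauCoercivityAtRecord
import Summits.QuantumFields.YangMills.Theorems.BalabanUVNodesK0Stub1FlatPropagatorsExistAtRecord
import HarnessLib

/-!
# K0⁷ STUB 1 (`stub_prop8StepCoP13`), sub-target S4a, THE FLAT JUNCTION WITH S1, PART 2: **PRINT's `Δ_a = Δ(1) + ∂R∂* + aQ*Q` ((128)) ON S1's CARRIER —
# [Balaban1984PropagatorsI] PROP. 1.1 (1.90) WITH THE RESIDUAL-GAUGE PROJECTION `R` ([15] (153) «the gauge condition `R d^{η*}A = 0`») READ ENTRYWISE ON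
# 𝔰𝔲(N)-VALUED BOND FIELDS OF THE RECORD's FINE TORUS**: `Δ_1 = Node00.hessOpAt η 1` (S1) is COERCIVE on the R-gauge ∩ `ker Q_k` tangent space, `k`- and
# volume-uniformly; file 2's `hpos` DISCHARGED there and print's `G̃` EXISTS there (companion of `…K0Stub1FlatHessianLandauCoercivityAtRecord`, which has
# the FULL Landau condition `∂*X = 0` instead of print's `R∂*X = 0`)

Cell `pub-ymgap`, width seat `pub-ymgap-k0-s1-w1` g2 (trigger (t1) of g0's HANDOFF).  `--kind proof --supports stmt-QuantumFields-20541 --as helper`; count-neutral.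
[15] = [Balaban1985Variational] (CMP **102** (1985) 277–309); [B5] = [Balaban1984PropagatorsI] (CMP **95** (1984) 17–40); [B6] = [Balaban1984PropagatorsII] (CMP **96** (1984)
223–250); [5] = [Balaban1985BackgroundPropagators] (CMP **99** (1985) 389–434).

WHY.  [15] Sect. F works in the AVERAGING-ADAPTED Landau gauge (153) `R ∂^{η*}A = 0` of [6] (1.31), `R` = [B5] (1.70)–(1.72)'s residual projection — NOT the full
Landau condition; and (128)'s `Δ_a = Δ + DRD* + Q*aQ` «is positive definite» on ALL fields ([5] Thm 3.11; flat case [B5] Prop. 1.1 (1.90)), which is what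
`G = Δ_a⁻¹` ((129) p.297; the `G` behind the minimiser `H` of (45) p.285) needs.  UST typed exactly this flat inequality WITH `R` for REAL SCALAR bond fields (`Prop7FlatCoercivityR.flat_coercive_R`:
`γ(d,a)·Σ_b A(b)² ≤ Σ_p (curl (L^k) A p)² + ‖R∂*A‖² + a·L^{kd}·Σ_c (Q_kA)(c)²`, `γ(d,a) = 1∕((d+1)·Cst d a)`, one-level structure `twoScale k _ ∅`, `R = B6SectAOperatorsV1.RE`,
`∂* = dsE`), and g0's file 4 read its form version at the record on lit-balaban's scalar carrier.  THIS FILE reads it ENTRYWISE on S1's carrier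
`TangentBondSU (F.P K) 0 N` (print p. 288: operators act on Lie-algebra-valued fields with «suppressed matrix indices»): the curl square is `L^{2k}·N·⟪X, Δ_1X⟫`
(part 1's `inner_hessOpAt_one_self_eq_sum_curl_re_im`), the `R∂*` and `Q_k` squares stay displayed entrywise.

WHAT IS PROVED (sorry-free; no definition; axioms standard).
* §0 `curl_eq_smul_curl_one`, `sum_curl_sq_eq_mul` (lattice-factor scaling of `LatticeFieldCalculus.curl`).
* §1 ★★ `normSq_le_hessOpAt_add_Rdiv_add_bondAvgIter_T4` — [B5] (1.90) WITH `R`, for 𝔰𝔲(N)-valued `X` on `Site (F.P K) 0`, `k + 1 ≤ m + K`, every `a > 0`: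
  `(1∕(5·Cst 4 a))·‖X‖² ≤ L^{2k}·N·⟪X, Δ_1X⟫ + Σ_{ii′}(‖R∂*(Re X_{ii′})‖² + ‖R∂*(Im X_{ii′})‖²) + a·L^{4k}·Σ_c Σ_{ii′}|(Q_kX)(c)_{ii′}|²` — print's «`Δ_a` positive
  definite» with its three terms displayed, constants independent of `m`, `K`, `k`, `N`.
* §2 ★★ `hessOpAt_one_coercive_of_Rgauge_of_bondAvgIter_eq_zero_T4` — on the R-GAUGE ∩ `ker Q_k` tangent space ((153) entrywise: `R∂*(Re X_{ii′}) = R∂*(Im X_{ii′}) = 0`;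
  `Q_kX = 0`): `(1∕(5·Cst 4 a))·‖X‖² ≤ L^{2k}·N·⟪X, Δ_1X⟫`.
* §3 ★ `re_bondPair_le_re_hessPair_of_Rgauge_T4` — the same in PRINT's pairing (3.11) at `η = η_k = L^{−k}`: `(1∕(5·Cst 4 a))·Re⟨A_X, A_X⟩ ≤ Re⟨A_X, Δ^{η_k}(1)A_X⟩`.
* §4 ★ `hessOpAt_one_pos_of_le_Rgauge_ker_T4` (file 2's `hpos` for `Δ := Δ_1` on every submodule `T ⊆` R-gauge ∩ `ker Q_k`), `norm_restricted_solution_hessOpAt_le_Rgauge_T4`,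
  ★ `exists_flatGt_hessOpAt_Rgauge_T4` (print's `G̃` on `T`: exists, linear, values in `T`, unique, `‖G̃w‖ ≤ 5·Cst 4 a·N·L^{2k}·‖w‖`),
  ★ `exists_Gt_eq158_hessOpAt_Rgauge_T4` ((127) ⟹ (158) on S1's carrier for every constraint map `Qc` with `ker Qc ⊆` R-gauge ∩ `ker Q_k`).
HONEST SCOPE.  (i) ONE averaging level (`Q_k = LatticeFieldCalculus.bondAvgIter k`; `R = RE (twoScale k _ ∅)` of lit-balaban, = [B5] (1.70)'s `I − P` on the torus by
`B6ProjR212TorusBridge`), whole torus, FLAT background; the (153) token AT THE RECORD (a torus-side predicate for `R ∂^{η*}A = 0`, STUB1-SECTF-MAP row (153): «NOT at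
objects») is NOT typed here — the hypothesis is displayed in lit-balaban's letters `RE ∘ dsE` entrywise, which is what a typed (153) must meet; the multi-level `genSet`
tangent space and the cube (144) boundary conditions are NOT treated.  (ii) Nothing of Bałaban's analysis asserted beyond the tree theorems cited; `stub_prop8StepCoP13` ∕ K0⁷
NOT closed; N07 NOT discharged; counts unmoved (28∕28 · 5∕27); one finite 𝕋⁴ programme at fixed ε — R4 closes the conditional finite-𝕋⁴ rung `BalabanLadder.UV` only,
never the summit; the YM mass gap (Clay) is NOT proved by any of this; nothing continuum ∕ ℝ⁴ ∕ OS.  No `sorry`, no `def`, no `instance`, no `notation`.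

References: [B5] Prop. 1.1 (1.89)–(1.90) p.33, (1.69)–(1.72) pp.29–30; [B6] (2.17)–(2.19) p.226; [5] (3.10)–(3.11) p.392, Thm 3.11 p.416; [15] (45)–(46) p.285 ((45) = `H`'s defining constraints, (46) = the bounds on `HB`), (129) p.297, p.288,
(127)–(133) pp.297–298, (143) p.300, (153) p.301, (158) p.302.

v1.0.1 (g2; DOCSTRINGS ONLY — declarations ∕ statements ∕ proofs byte-identical to v1 p593935): the attribution «`G = Δ_a⁻¹` ((46)∕(129))» corrected per ref-O READ-42's LOCATED-1 on the
sibling file p587257 — [15] (46) p.285 is the BOUND on `HB`, (45) the defining constraints of `H`, (129) p.297 the formulas `H₀ = GQ*(QGQ*)⁻¹`, `G = Δ_a⁻¹`.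
-/

set_option autoImplicit false
noncomputable section
open scoped BigOperators InnerProductSpace RealInnerProductSpace

namespace Summit.QuantumFields.YangMills.Theorems.K0Stub1FlatHessianRGaugeCoercivity

open Literature.MathematicalPhysics.QuantumFieldTheory.Balaban1983to89
open Literature.MathematicalPhysics.QuantumFieldTheory.Balaban1983to89.Node00
open Literature.MathematicalPhysics.QuantumFieldTheory.Balaban1983to89.T4Continuum (T4Family)
open T4AdjointCovarianceUnitary (lieSU)
open B9TorusCalculus (torusT)
open LatticeFieldCalculus (curl diverg bondAvgIter)
open B6SectADomainsV1 B6SectAOperatorsV1 B6SectCTwoScaleV1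
open Literature.MathematicalPhysics.QuantumFieldTheory.BalabanImbrieJaffe1984to88.BIJ85AxialPropagator411 (BondSpace)
open Summit.QuantumFields.YangMills.Theorems.Prop7FlatCoercivityR (flat_coercive_R)
open Summit.QuantumFields.YangMills.Theorems.K0Stub1FlatPropagatorsExistAtRecord (one_le_Cst succ_le_m_add_K)
open Summit.QuantumFields.YangMills.Theorems.K0Stub1CriticalEquation143CoordFree (exists_restrictedSolutionOp exists_Gt_eq158_of_critical128)
open Summit.QuantumFields.YangMills.Theorems.K0Stub1FlatHessianLandauCoercivity (normSq_tangentBondSU_eq_sum_entries sum_entries_re_im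
  inner_hessOpAt_one_self_eq_sum_curl_re_im bondAvgIter_entry_re bondAvgIter_entry_im eta_T4_eq)

variable {N : ℕ} {P : Params} {j : ℕ}

/-! ## §0  Lattice-factor scaling of the plaquette curl -/

/-- `curl c A p = c • curl 1 A p` (the lattice factor `c = η⁻¹` of [B5] (1.2) pulled out). [cite: Balaban1984PropagatorsI, (1.2) p.18] -/
theorem curl_eq_smul_curl_one {V : Type*} [AddCommGroup V] [Module ℝ V] (c : ℝ) (A : VecField P j V) (p : Plaq P j) :
    curl c A p = c • curl 1 A p := by
  simp only [LatticeFieldCalculus.curl, one_smul]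

/-- `Σ_p (curl c A p)² = c²·Σ_p (curl 1 A p)²` for a real bond field. [cite: Balaban1984PropagatorsI, (1.2) p.18] -/
theorem sum_curl_sq_eq_mul (c : ℝ) (A : VecField P j ℝ) : ∑ p : Plaq P j, curl c A p ^ 2 = c ^ 2 * ∑ p : Plaq P j, curl 1 A p ^ 2 := by
  rw [Finset.mul_sum]
  exact Finset.sum_congr rfl fun p _ => by rw [curl_eq_smul_curl_one c A p, smul_eq_mul, mul_pow]

variable [NeZero N]

/-! ## §1  ★★ [B5] (1.90) WITH THE RESIDUAL-GAUGE PROJECTION `R`, entrywise on S1's carrier -/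

section Record

variable (F : T4Family) (K k : ℕ)

/-- ★★ **PRINT's «`Δ_a = Δ(1) + ∂R∂* + aQ*Q` IS POSITIVE DEFINITE» ((128)–(129)) AT THE RECORD, FLAT, ENTRYWISE ON 𝔰𝔲(N)-VALUED BOND FIELDS, THREE SQUARES DISPLAYED**
(fine torus `Site (F.P K) 0`, `k + 1 ≤ m + K`, every `a > 0`, `η ≠ 0`): for `X : TangentBondSU (F.P K) 0 N`,
`(1∕(5·Cst 4 a))·‖X‖² ≤ L^{2k}·N·⟪X, Δ_1X⟫ + Σ_{ii′}(‖R∂*(Re X_{ii′})‖² + ‖R∂*(Im X_{ii′})‖²) + a·L^{4k}·Σ_c Σ_{ii′}|(Q_kX)(c)_{ii′}|²` — `Δ_1 = hessOpAt η 1` (S1),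
`R∂* = RE (twoScale k _ ∅) (L^k) ∘ dsE (L^k)` (lit-balaban; [B5] (1.70)–(1.72) ∕ [B6] (2.17)), `Q_k = bondAvgIter k`; constants independent of `m`, `K`, `k`, `N`.
UST `Prop7FlatCoercivityR.flat_coercive_R` on each of the `2N²` real components, summed. [cite: Balaban1984PropagatorsI, Prop. 1.1 (1.89)–(1.90) p.33, (1.69)–(1.72) pp.29–30; Balaban1985Variational, (128)–(129) pp.297–298, p.288; Balaban1985BackgroundPropagators, Thm 3.11 p.416] -/
theorem normSq_le_hessOpAt_add_Rdiv_add_bondAvgIter_T4 (hk1 : k + 1 ≤ F.m + K) {a : ℝ} (ha : 0 < a) {η : ℝ} (hη : η ≠ 0)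
    (X : TangentBondSU (F.P K) 0 N) :
    (1 / (5 * B5Prop11Plancherel.Cst 4 a)) * ‖X‖ ^ 2 ≤
      ((F.L : ℝ) ^ k) ^ 2 * ((N : ℝ) * ⟪X, hessOpAt η (1 : GaugeField (F.P K) 0 (SU N)) X⟫_ℝ)
        + ∑ i, ∑ i',
            (‖RE (twoScale k (succ_le_m_add_K F K k hk1) (∅ : Finset (Site (F.P K) (k + 1)))) ((F.L : ℝ) ^ k)
                  (dsE ((F.L : ℝ) ^ k) (WithLp.toLp 2 fun b => (((X b : lieSU (Fin N)) : Matrix (Fin N) (Fin N) ℂ) i i').re))‖ ^ 2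
              + ‖RE (twoScale k (succ_le_m_add_K F K k hk1) (∅ : Finset (Site (F.P K) (k + 1)))) ((F.L : ℝ) ^ k)
                  (dsE ((F.L : ℝ) ^ k) (WithLp.toLp 2 fun b => (((X b : lieSU (Fin N)) : Matrix (Fin N) (Fin N) ℂ) i i').im))‖ ^ 2)
        + a * ((F.L : ℝ) ^ k) ^ 4 * ∑ c : PBond (F.P K) k, ∑ i, ∑ i',
            ‖bondAvgIter k (fun b => ((X b : lieSU (Fin N)) : Matrix (Fin N) (Fin N) ℂ)) c i i'‖ ^ 2 := by
  set A : VecField (F.P K) 0 (Matrix (Fin N) (Fin N) ℂ) := fun b => ((X b : lieSU (Fin N)) : Matrix (Fin N) (Fin N) ℂ)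
  have hN : (N : ℝ) ≠ 0 := Nat.cast_ne_zero.mpr (NeZero.ne N)
  -- the matrix-side quantities in the `2N²` real components
  have hX : ‖X‖ ^ 2 = ∑ i, ∑ i', (∑ b, (A b i i').re ^ 2 + ∑ b, (A b i i').im ^ 2) := by
    rw [normSq_tangentBondSU_eq_sum_entries, sum_entries_re_im]
  have hH : (N : ℝ) * ⟪X, hessOpAt η (1 : GaugeField (F.P K) 0 (SU N)) X⟫_ℝ =
      ∑ i, ∑ i', (∑ p, curl 1 (fun b => (A b i i').re) p ^ 2 + ∑ p, curl 1 (fun b => (A b i i').im) p ^ 2) := by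
    rw [inner_hessOpAt_one_self_eq_sum_curl_re_im hη, ← mul_assoc, mul_inv_cancel₀ hN, one_mul]
  have hQ : ∑ c : PBond (F.P K) k, ∑ i, ∑ i', ‖bondAvgIter k A c i i'‖ ^ 2 =
      ∑ i, ∑ i', (∑ c, bondAvgIter k (fun b => (A b i i').re) c ^ 2 + ∑ c, bondAvgIter k (fun b => (A b i i').im) c ^ 2) := by
    rw [sum_entries_re_im]; simp only [bondAvgIter_entry_re, bondAvgIter_entry_im]
  rw [hX, hQ, hH]
  -- UST's (1.90)-with-`R` on each real component (`(F.P K).L = F.L`, `(F.P K).d = 4`, `ofLp (toLp f) = f` by `rfl`)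
  have hcomp : ∀ Y : VecField (F.P K) 0 ℝ,
      (1 / (5 * B5Prop11Plancherel.Cst 4 a)) * ∑ b, Y b ^ 2 ≤
        ((F.L : ℝ) ^ k) ^ 2 * ∑ p, curl 1 Y p ^ 2
          + ‖RE (twoScale k (succ_le_m_add_K F K k hk1) (∅ : Finset (Site (F.P K) (k + 1)))) ((F.L : ℝ) ^ k)
              (dsE ((F.L : ℝ) ^ k) (WithLp.toLp 2 Y))‖ ^ 2
          + a * ((F.L : ℝ) ^ k) ^ 4 * ∑ c, bondAvgIter k Y c ^ 2 := fun Y => by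
    have h := flat_coercive_R (P := F.P K) (succ_le_m_add_K F K k hk1) ha (WithLp.toLp 2 Y)
    simp only [T4Family.P_L, T4Family.P_d, sum_curl_sq_eq_mul ((F.L : ℝ) ^ k)] at h
    norm_num at h ⊢
    exact h
  calc (1 / (5 * B5Prop11Plancherel.Cst 4 a)) * ∑ i, ∑ i', (∑ b, (A b i i').re ^ 2 + ∑ b, (A b i i').im ^ 2)
      = ∑ i, ∑ i', ((1 / (5 * B5Prop11Plancherel.Cst 4 a)) * ∑ b, (A b i i').re ^ 2
          + (1 / (5 * B5Prop11Plancherel.Cst 4 a)) * ∑ b, (A b i i').im ^ 2) := by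
        simp only [Finset.mul_sum, mul_add]
    _ ≤ _ := Finset.sum_le_sum fun i _ => Finset.sum_le_sum fun i' _ =>
          add_le_add (hcomp fun b => (A b i i').re) (hcomp fun b => (A b i i').im)
    _ = _ := by simp only [Finset.sum_add_distrib, ← Finset.mul_sum]; ring

/-- ★★ **`Δ_1` OF RECORD IS COERCIVE ON PRINT's R-GAUGE ∩ `ker Q_k` TANGENT SPACE, `k`- AND VOLUME-UNIFORMLY**: for an 𝔰𝔲(N)-valued `X` on `Site (F.P K) 0` in the
averaging-adapted Landau gauge (153) read entrywise (`R∂*(Re X_{ii′}) = R∂*(Im X_{ii′}) = 0`) with `Q_kX = 0` (`k + 1 ≤ m + K`), and every `a > 0`: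
`(1∕(5·Cst 4 a))·‖X‖² ≤ L^{2k}·N·⟪X, Δ_1 X⟫` — on that space print's `Δ_a` ((128)) IS `Δ(1)`, so this is the `hpos` input of file 2's (127) ⟹ (143) ⟹ (158) there.
[cite: Balaban1984PropagatorsI, Prop. 1.1 (1.89)–(1.90) p.33; Balaban1985Variational, (128)–(131) p.298, (153) p.301; Balaban1985BackgroundPropagators, Thm 3.11 p.416] -/
theorem hessOpAt_one_coercive_of_Rgauge_of_bondAvgIter_eq_zero_T4 (hk1 : k + 1 ≤ F.m + K) {a : ℝ} (ha : 0 < a) {η : ℝ} (hη : η ≠ 0)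
    (X : TangentBondSU (F.P K) 0 N)
    (hR : ∀ i i' : Fin N,
      RE (twoScale k (succ_le_m_add_K F K k hk1) (∅ : Finset (Site (F.P K) (k + 1)))) ((F.L : ℝ) ^ k)
          (dsE ((F.L : ℝ) ^ k) (WithLp.toLp 2 fun b => (((X b : lieSU (Fin N)) : Matrix (Fin N) (Fin N) ℂ) i i').re)) = 0 ∧
        RE (twoScale k (succ_le_m_add_K F K k hk1) (∅ : Finset (Site (F.P K) (k + 1)))) ((F.L : ℝ) ^ k)
          (dsE ((F.L : ℝ) ^ k) (WithLp.toLp 2 fun b => (((X b : lieSU (Fin N)) : Matrix (Fin N) (Fin N) ℂ) i i').im)) = 0)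
    (havg : ∀ c : PBond (F.P K) k, bondAvgIter k (fun b => ((X b : lieSU (Fin N)) : Matrix (Fin N) (Fin N) ℂ)) c = 0) :
    (1 / (5 * B5Prop11Plancherel.Cst 4 a)) * ‖X‖ ^ 2 ≤
      ((F.L : ℝ) ^ k) ^ 2 * ((N : ℝ) * ⟪X, hessOpAt η (1 : GaugeField (F.P K) 0 (SU N)) X⟫_ℝ) := by
  have h := normSq_le_hessOpAt_add_Rdiv_add_bondAvgIter_T4 F K k hk1 ha hη X
  have hRsum : ∑ i : Fin N, ∑ i' : Fin N,
      (‖RE (twoScale k (succ_le_m_add_K F K k hk1) (∅ : Finset (Site (F.P K) (k + 1)))) ((F.L : ℝ) ^ k)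
            (dsE ((F.L : ℝ) ^ k) (WithLp.toLp 2 fun b => (((X b : lieSU (Fin N)) : Matrix (Fin N) (Fin N) ℂ) i i').re))‖ ^ 2
        + ‖RE (twoScale k (succ_le_m_add_K F K k hk1) (∅ : Finset (Site (F.P K) (k + 1)))) ((F.L : ℝ) ^ k)
            (dsE ((F.L : ℝ) ^ k) (WithLp.toLp 2 fun b => (((X b : lieSU (Fin N)) : Matrix (Fin N) (Fin N) ℂ) i i').im))‖ ^ 2) = 0 :=
    Finset.sum_eq_zero fun i _ => Finset.sum_eq_zero fun i' _ => by
      rw [(hR i i').1, (hR i i').2, norm_zero]; ring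
  have hQsum : ∑ c : PBond (F.P K) k, ∑ i : Fin N, ∑ i' : Fin N,
      ‖bondAvgIter k (fun b => ((X b : lieSU (Fin N)) : Matrix (Fin N) (Fin N) ℂ)) c i i'‖ ^ 2 = 0 :=
    Finset.sum_eq_zero fun c _ => by simp only [havg c, Matrix.zero_apply, norm_zero]; simp
  rw [hRsum, hQsum, add_zero, mul_zero, add_zero] at h
  exact h

end Record

/-! ## §3  ★ The same in PRINT's pairing (3.11) at `η = η_k` -/

section PrintPairing

open scoped Matrix.Norms.L2Operator
open B9Eq39Adjoint (bondPair hessPair)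
open B12Eq18Current (dirForm)

variable (F : T4Family) (K k : ℕ)

/-- ★ **(1.90)-WITH-`R` IN PRINT's OWN PAIRING (3.11) AT THE RECORD, FLAT, ON THE R-GAUGE ∩ `ker Q_k` TANGENT SPACE**: at `η = η_k = L^{−k}`, for every 𝔰𝔲(N)-valued `X`
with `R∂*X = 0` entrywise and `Q_kX = 0` (`k + 1 ≤ m + K`), every `a > 0`: `(1∕(5·Cst 4 a))·Re⟨A_X, A_X⟩ ≤ Re⟨A_X, Δ^{η_k}(1) A_X⟩` — «`Δ(1) ≥ γ₀·I`» on print's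
tangent space with `γ₀ = 1∕(5·Cst 4 a)` independent of `k`, `m`, `K`, `N` (S1's `re_bondPair_hermLetter`, `inner_hessOpAt_self`; `η_k²·L^{2k} = 1`).
[cite: Balaban1984PropagatorsI, Prop. 1.1 (1.89)–(1.90) p.33; Balaban1985BackgroundPropagators, (3.10)–(3.11) p.392, Thm 3.11 p.416; Balaban1985Variational, (153) p.301] -/
theorem re_bondPair_le_re_hessPair_of_Rgauge_T4 (hk1 : k + 1 ≤ F.m + K) {a : ℝ} (ha : 0 < a) (X : TangentBondSU (F.P K) 0 N)
    (hR : ∀ i i' : Fin N,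
      RE (twoScale k (succ_le_m_add_K F K k hk1) (∅ : Finset (Site (F.P K) (k + 1)))) ((F.L : ℝ) ^ k)
          (dsE ((F.L : ℝ) ^ k) (WithLp.toLp 2 fun b => (((X b : lieSU (Fin N)) : Matrix (Fin N) (Fin N) ℂ) i i').re)) = 0 ∧
        RE (twoScale k (succ_le_m_add_K F K k hk1) (∅ : Finset (Site (F.P K) (k + 1)))) ((F.L : ℝ) ^ k)
          (dsE ((F.L : ℝ) ^ k) (WithLp.toLp 2 fun b => (((X b : lieSU (Fin N)) : Matrix (Fin N) (Fin N) ℂ) i i').im)) = 0)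
    (havg : ∀ c : PBond (F.P K) k, bondAvgIter k (fun b => ((X b : lieSU (Fin N)) : Matrix (Fin N) (Fin N) ℂ)) c = 0) :
    (1 / (5 * B5Prop11Plancherel.Cst 4 a)) *
        (bondPair ((F.P K).eta k) 4 ((N : ℂ)⁻¹ • Matrix.traceLinearMap (Fin N) ℂ ℂ)
          (hermLetter ((F.P K).eta k) (1 : GaugeField (F.P K) 0 (SU N)) X)
          (hermLetter ((F.P K).eta k) (1 : GaugeField (F.P K) 0 (SU N)) X)).re
      ≤ (hessPair (torusT (F.P K) 0) (dirForm (cfgGL N (1 : GaugeField (F.P K) 0 (SU N)))) ((F.P K).eta k) 4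
          ((N : ℂ)⁻¹ • Matrix.traceLinearMap (Fin N) ℂ ℂ) (hermLetter ((F.P K).eta k) (1 : GaugeField (F.P K) 0 (SU N)) X)).re := by
  have hη : (F.P K).eta k ≠ 0 := (eta_T4_eq F K k).2.ne'
  have hN : (N : ℝ) ≠ 0 := Nat.cast_ne_zero.mpr (NeZero.ne N)
  have hNpos : (0 : ℝ) < N := Nat.cast_pos.mpr (Nat.pos_of_ne_zero (NeZero.ne N))
  have hL : (0 : ℝ) < F.L := Nat.cast_pos.mpr (lt_trans Nat.zero_lt_one F.hL.2)
  have hLk : ((F.L : ℝ) ^ k) ^ 2 ≠ 0 := by positivity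
  have h := hessOpAt_one_coercive_of_Rgauge_of_bondAvgIter_eq_zero_T4 F K k hk1 ha hη X hR havg
  have hη2 : ((F.P K).eta k) ^ 2 = (((F.L : ℝ) ^ k) ^ 2)⁻¹ := by rw [(eta_T4_eq F K k).1, inv_pow]
  rw [re_bondPair_hermLetter hη, ← inner_hessOpAt_self, real_inner_self_eq_norm_sq, hη2]
  calc (1 / (5 * B5Prop11Plancherel.Cst 4 a)) * ((((F.L : ℝ) ^ k) ^ 2)⁻¹ / N * ‖X‖ ^ 2)
      = ((((F.L : ℝ) ^ k) ^ 2)⁻¹ * (N : ℝ)⁻¹) * ((1 / (5 * B5Prop11Plancherel.Cst 4 a)) * ‖X‖ ^ 2) := by ring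
    _ ≤ ((((F.L : ℝ) ^ k) ^ 2)⁻¹ * (N : ℝ)⁻¹) * (((F.L : ℝ) ^ k) ^ 2 * ((N : ℝ) * ⟪X, hessOpAt ((F.P K).eta k) (1 : GaugeField (F.P K) 0 (SU N)) X⟫_ℝ)) :=
        mul_le_mul_of_nonneg_left h (by positivity)
    _ = ⟪X, hessOpAt ((F.P K).eta k) (1 : GaugeField (F.P K) 0 (SU N)) X⟫_ℝ := by
        field_simp

end PrintPairing

/-! ## §4  ★ Consequences on S1's carrier: `hpos`, the `L²` letter, print's `G̃`, (127) ⟹ (158) — on the R-gauge ∩ `ker Q_k` tangent spaces -/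

section Consequences

variable (F : T4Family) (K k : ℕ)

/-- ★ **FILE 2's `hpos` ON S1's CARRIER FOR PRINT's TANGENT SPACES**: for every submodule `T` of 𝔰𝔲(N)-valued bond fields of the record's fine torus inside the R-gauge ∩
`ker Q_k` fields (`k + 1 ≤ m + K`), `Δ_1 = hessOpAt η 1` is POSITIVE on `T`. [cite: Balaban1985Variational, (128)–(131) p.298, (153) p.301; Balaban1984PropagatorsI, Prop. 1.1 (1.90) p.33] -/
theorem hessOpAt_one_pos_of_le_Rgauge_ker_T4 (hk1 : k + 1 ≤ F.m + K) {η : ℝ} (hη : η ≠ 0) (T : Submodule ℝ (TangentBondSU (F.P K) 0 N))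
    (hT : ∀ X ∈ T, (∀ i i' : Fin N,
        RE (twoScale k (succ_le_m_add_K F K k hk1) (∅ : Finset (Site (F.P K) (k + 1)))) ((F.L : ℝ) ^ k)
            (dsE ((F.L : ℝ) ^ k) (WithLp.toLp 2 fun b => (((X b : lieSU (Fin N)) : Matrix (Fin N) (Fin N) ℂ) i i').re)) = 0 ∧
          RE (twoScale k (succ_le_m_add_K F K k hk1) (∅ : Finset (Site (F.P K) (k + 1)))) ((F.L : ℝ) ^ k)
            (dsE ((F.L : ℝ) ^ k) (WithLp.toLp 2 fun b => (((X b : lieSU (Fin N)) : Matrix (Fin N) (Fin N) ℂ) i i').im)) = 0) ∧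
      ∀ c : PBond (F.P K) k, bondAvgIter k (fun b => ((X b : lieSU (Fin N)) : Matrix (Fin N) (Fin N) ℂ)) c = 0) :
    ∀ z ∈ T, z ≠ 0 → 0 < ⟪z, hessOpAt η (1 : GaugeField (F.P K) 0 (SU N)) z⟫_ℝ := by
  intro z hz hz0
  have h := hessOpAt_one_coercive_of_Rgauge_of_bondAvgIter_eq_zero_T4 F K k hk1 one_pos hη z (hT z hz).1 (hT z hz).2
  have hNpos : (0 : ℝ) < N := Nat.cast_pos.mpr (Nat.pos_of_ne_zero (NeZero.ne N))
  have hL : (0 : ℝ) < F.L := Nat.cast_pos.mpr (lt_trans Nat.zero_lt_one F.hL.2)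
  have hC : 0 < 5 * B5Prop11Plancherel.Cst 4 1 := by linarith [one_le_Cst 4 (1 : ℝ)]
  have hzn : 0 < ‖z‖ := norm_pos_iff.mpr hz0
  have hlhs : 0 < (1 / (5 * B5Prop11Plancherel.Cst 4 1)) * ‖z‖ ^ 2 := by positivity
  have h1 : 0 < ((F.L : ℝ) ^ k) ^ 2 * ((N : ℝ) * ⟪z, hessOpAt η (1 : GaugeField (F.P K) 0 (SU N)) z⟫_ℝ) := lt_of_lt_of_le hlhs h
  exact (mul_pos_iff_of_pos_left hNpos).mp ((mul_pos_iff_of_pos_left (by positivity)).mp h1)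

/-- The `L²` letter of a restricted solution of `Δ_1` on such a `T`: `⟪δ, Δ_1 z⟫ = ⟪δ, v⟫` on `T ∋ z` ⇒ `‖z‖ ≤ 5·Cst 4 a·N·L^{2k}·‖v‖`, every `a > 0`.
[cite: Balaban1984PropagatorsI, Prop. 1.1 (1.90) p.33; Balaban1985Variational, (46) p.285 (the `L²` analogue of that letter), (131) p.298] -/
theorem norm_restricted_solution_hessOpAt_le_Rgauge_T4 (hk1 : k + 1 ≤ F.m + K) {a : ℝ} (ha : 0 < a) {η : ℝ} (hη : η ≠ 0)
    (T : Submodule ℝ (TangentBondSU (F.P K) 0 N))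
    (hT : ∀ X ∈ T, (∀ i i' : Fin N,
        RE (twoScale k (succ_le_m_add_K F K k hk1) (∅ : Finset (Site (F.P K) (k + 1)))) ((F.L : ℝ) ^ k)
            (dsE ((F.L : ℝ) ^ k) (WithLp.toLp 2 fun b => (((X b : lieSU (Fin N)) : Matrix (Fin N) (Fin N) ℂ) i i').re)) = 0 ∧
          RE (twoScale k (succ_le_m_add_K F K k hk1) (∅ : Finset (Site (F.P K) (k + 1)))) ((F.L : ℝ) ^ k)
            (dsE ((F.L : ℝ) ^ k) (WithLp.toLp 2 fun b => (((X b : lieSU (Fin N)) : Matrix (Fin N) (Fin N) ℂ) i i').im)) = 0) ∧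
      ∀ c : PBond (F.P K) k, bondAvgIter k (fun b => ((X b : lieSU (Fin N)) : Matrix (Fin N) (Fin N) ℂ)) c = 0)
    {z v : TangentBondSU (F.P K) 0 N} (hz : z ∈ T)
    (hsol : ∀ δ ∈ T, ⟪δ, hessOpAt η (1 : GaugeField (F.P K) 0 (SU N)) z⟫_ℝ = ⟪δ, v⟫_ℝ) :
    ‖z‖ ≤ 5 * B5Prop11Plancherel.Cst 4 a * N * ((F.L : ℝ) ^ k) ^ 2 * ‖v‖ := by
  have h := hessOpAt_one_coercive_of_Rgauge_of_bondAvgIter_eq_zero_T4 F K k hk1 ha hη z (hT z hz).1 (hT z hz).2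
  rw [hsol z hz] at h
  have hNpos : (0 : ℝ) < N := Nat.cast_pos.mpr (Nat.pos_of_ne_zero (NeZero.ne N))
  have hL : (0 : ℝ) < F.L := Nat.cast_pos.mpr (lt_trans Nat.zero_lt_one F.hL.2)
  have hC : 0 < 5 * B5Prop11Plancherel.Cst 4 a := by linarith [one_le_Cst 4 a]
  have hcs : ⟪z, v⟫_ℝ ≤ ‖z‖ * ‖v‖ := real_inner_le_norm _ _
  by_cases hz0 : ‖z‖ = 0
  · rw [hz0]; positivity
  · have hzpos : 0 < ‖z‖ := lt_of_le_of_ne (norm_nonneg _) (Ne.symm hz0)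
    have h1 : (1 / (5 * B5Prop11Plancherel.Cst 4 a)) * ‖z‖ ^ 2 ≤ ((F.L : ℝ) ^ k) ^ 2 * ((N : ℝ) * (‖z‖ * ‖v‖)) :=
      h.trans (mul_le_mul_of_nonneg_left (mul_le_mul_of_nonneg_left hcs hNpos.le) (by positivity))
    have h2 : ‖z‖ ^ 2 ≤ 5 * B5Prop11Plancherel.Cst 4 a * N * ((F.L : ℝ) ^ k) ^ 2 * (‖z‖ * ‖v‖) := by
      have h3 := mul_le_mul_of_nonneg_left h1 hC.le
      have hC0 : B5Prop11Plancherel.Cst 4 a ≠ 0 := (lt_of_lt_of_le one_pos (one_le_Cst 4 a)).ne'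
      have hcc : 5 * B5Prop11Plancherel.Cst 4 a * ((1 / (5 * B5Prop11Plancherel.Cst 4 a)) * ‖z‖ ^ 2) = ‖z‖ ^ 2 := by
        field_simp
      rw [hcc] at h3
      calc ‖z‖ ^ 2 ≤ 5 * B5Prop11Plancherel.Cst 4 a * (((F.L : ℝ) ^ k) ^ 2 * ((N : ℝ) * (‖z‖ * ‖v‖))) := h3
        _ = 5 * B5Prop11Plancherel.Cst 4 a * N * ((F.L : ℝ) ^ k) ^ 2 * (‖z‖ * ‖v‖) := by ring
    nlinarith [h2, hzpos, norm_nonneg v, hC, hNpos]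

/-- ★ **PRINT's `G̃` ((131), (143)) EXISTS ON S1's CARRIER ON PRINT's TANGENT SPACES, WITH A `k`-UNIFORM `L²` LETTER**: for every submodule `T ⊆` R-gauge ∩ `ker Q_k`
of `TangentBondSU (F.P K) 0 N` (`k + 1 ≤ m + K`) there is an ℝ-linear `G̃` with values in `T`, `⟪δ, Δ_1(G̃w)⟫ = ⟪δ, w⟫` on `T`, UNIQUE, and
`‖G̃w‖ ≤ 5·Cst 4 a·N·L^{2k}·‖w‖` for every `a > 0`. [cite: Balaban1985Variational, (131) p.298, (143) p.300, (158) p.302; Balaban1984PropagatorsI, Prop. 1.1 (1.90) p.33] -/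
theorem exists_flatGt_hessOpAt_Rgauge_T4 (hk1 : k + 1 ≤ F.m + K) {a : ℝ} (ha : 0 < a) {η : ℝ} (hη : η ≠ 0)
    (T : Submodule ℝ (TangentBondSU (F.P K) 0 N))
    (hT : ∀ X ∈ T, (∀ i i' : Fin N,
        RE (twoScale k (succ_le_m_add_K F K k hk1) (∅ : Finset (Site (F.P K) (k + 1)))) ((F.L : ℝ) ^ k)
            (dsE ((F.L : ℝ) ^ k) (WithLp.toLp 2 fun b => (((X b : lieSU (Fin N)) : Matrix (Fin N) (Fin N) ℂ) i i').re)) = 0 ∧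
          RE (twoScale k (succ_le_m_add_K F K k hk1) (∅ : Finset (Site (F.P K) (k + 1)))) ((F.L : ℝ) ^ k)
            (dsE ((F.L : ℝ) ^ k) (WithLp.toLp 2 fun b => (((X b : lieSU (Fin N)) : Matrix (Fin N) (Fin N) ℂ) i i').im)) = 0) ∧
      ∀ c : PBond (F.P K) k, bondAvgIter k (fun b => ((X b : lieSU (Fin N)) : Matrix (Fin N) (Fin N) ℂ)) c = 0) :
    ∃ G : TangentBondSU (F.P K) 0 N →ₗ[ℝ] TangentBondSU (F.P K) 0 N,
      (∀ w, G w ∈ T ∧ ∀ δ ∈ T, ⟪δ, hessOpAt η (1 : GaugeField (F.P K) 0 (SU N)) (G w)⟫_ℝ = ⟪δ, w⟫_ℝ) ∧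
      (∀ w z : TangentBondSU (F.P K) 0 N, z ∈ T →
        (∀ δ ∈ T, ⟪δ, hessOpAt η (1 : GaugeField (F.P K) 0 (SU N)) z⟫_ℝ = ⟪δ, w⟫_ℝ) → z = G w) ∧
      ∀ w, ‖G w‖ ≤ 5 * B5Prop11Plancherel.Cst 4 a * N * ((F.L : ℝ) ^ k) ^ 2 * ‖w‖ := by
  obtain ⟨G, hG, huniq⟩ := exists_restrictedSolutionOp T (hessOpAt η (1 : GaugeField (F.P K) 0 (SU N)))
    (hessOpAt_one_pos_of_le_Rgauge_ker_T4 F K k hk1 hη T hT)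
  exact ⟨G, hG, huniq, fun w => norm_restricted_solution_hessOpAt_le_Rgauge_T4 F K k hk1 ha hη T hT (hG w).1 (hG w).2⟩

/-- ★ **[15] (127) ⟹ (158) ON S1's CARRIER FOR PRINT's TANGENT SPACES, `hpos` DISCHARGED**: for every ℝ-linear constraint map `Qc` whose kernel lies inside the
R-gauge ∩ `ker Q_k` fields (e.g. `Qc = (Q_k, R∂*)` jointly — (156)–(157) with (153); `k + 1 ≤ m + K`) and every right inverse `H` of `Qc` with `Δ_1`-orthogonal range,
there is an ℝ-linear `G̃` (values in `ker Qc`, `⟪δ, Δ_1(G̃v)⟫ = ⟪δ, v⟫` on `ker Qc`) such that for EVERY `W` and every `A′` critical in the sense (128) on `ker Qc`,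
`A₁ := A′ − H(QcA′)` solves *«A₁ + G̃((δ∕δA′)V)(A₁ + HB) = 0. (158)»*. [cite: Balaban1985Variational, (127)–(133) pp.297–298, (143) p.300, (153) p.301, (158) p.302] -/
theorem exists_Gt_eq158_hessOpAt_Rgauge_T4 (hk1 : k + 1 ≤ F.m + K) {η : ℝ} (hη : η ≠ 0) {Fc : Type*} [AddCommGroup Fc] [Module ℝ Fc]
    (Qc : TangentBondSU (F.P K) 0 N →ₗ[ℝ] Fc)
    (hQc : ∀ X ∈ LinearMap.ker Qc, (∀ i i' : Fin N,
        RE (twoScale k (succ_le_m_add_K F K k hk1) (∅ : Finset (Site (F.P K) (k + 1)))) ((F.L : ℝ) ^ k)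
            (dsE ((F.L : ℝ) ^ k) (WithLp.toLp 2 fun b => (((X b : lieSU (Fin N)) : Matrix (Fin N) (Fin N) ℂ) i i').re)) = 0 ∧
          RE (twoScale k (succ_le_m_add_K F K k hk1) (∅ : Finset (Site (F.P K) (k + 1)))) ((F.L : ℝ) ^ k)
            (dsE ((F.L : ℝ) ^ k) (WithLp.toLp 2 fun b => (((X b : lieSU (Fin N)) : Matrix (Fin N) (Fin N) ℂ) i i').im)) = 0) ∧
      ∀ c : PBond (F.P K) k, bondAvgIter k (fun b => ((X b : lieSU (Fin N)) : Matrix (Fin N) (Fin N) ℂ)) c = 0)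
    (H : Fc →ₗ[ℝ] TangentBondSU (F.P K) 0 N) (hQH : ∀ B, Qc (H B) = B)
    (hHorth : ∀ δ ∈ LinearMap.ker Qc, ∀ B, ⟪δ, hessOpAt η (1 : GaugeField (F.P K) 0 (SU N)) (H B)⟫_ℝ = 0) :
    ∃ G : TangentBondSU (F.P K) 0 N →ₗ[ℝ] TangentBondSU (F.P K) 0 N,
      (∀ v, G v ∈ LinearMap.ker Qc ∧ ∀ δ ∈ LinearMap.ker Qc, ⟪δ, hessOpAt η (1 : GaugeField (F.P K) 0 (SU N)) (G v)⟫_ℝ = ⟪δ, v⟫_ℝ) ∧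
      ∀ (W : TangentBondSU (F.P K) 0 N → TangentBondSU (F.P K) 0 N) (A' : TangentBondSU (F.P K) 0 N),
        (∀ δ ∈ LinearMap.ker Qc, ⟪δ, hessOpAt η (1 : GaugeField (F.P K) 0 (SU N)) A' + W A'⟫_ℝ = 0) →
        (A' - H (Qc A')) + G (W ((A' - H (Qc A')) + H (Qc A'))) = 0 :=
  exists_Gt_eq158_of_critical128 (hessOpAt η (1 : GaugeField (F.P K) 0 (SU N))) Qc
    (hessOpAt_one_pos_of_le_Rgauge_ker_T4 F K k hk1 hη (LinearMap.ker Qc) hQc) H hQH hHorth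

end Consequences

end Summit.QuantumFields.YangMills.Theorems.K0Stub1FlatHessianRGaugeCoercivity

end
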